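import Mathlib.Algebra.Order.Field.Basic
import Mathlib.Algebra.Order.Ring.Rat
import Mathlib.Tactic.Linarith
import Mathlib.Tactic.NormNum
import Mathlib.Tactic.Positivity
import Summits.Ventures.CertifiedManyBodySolver.Downfold.PhaseMapCellScore

/-!
# The certified-ANNEX arithmetic of the material-oracle acceptance test: the kelvin conversion of a t-quoted
# T_c bound (weakest-edge rule, outward rounding) and the H1 contradiction check, with SOUNDNESS proved

Venture CertifiedManyBodySolver, cell `pub/hubbard-downfold`, seat hubbard-downfold-score-1 (second scoring
engine); namespace `Summit.Ventures.CertifiedManyBodySolver.Downfold.CellScore` (continues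
`PhaseMapCellScore.lean`: `inside`, `tau`). Everything here is PROVED (linear arithmetic over `ℚ`).

WHAT THIS IS NOT: not a certificate about any material and not a KT bound — the ceilings themselves live in
`Observables/KTTransitionCeiling*.lean` (hubbard-tc) and reach a material map only modulo the uncertified router box and
the model→material dictionary (ACCEPTANCE §2.1 «DICTIONARY CONDITION»). This file is the KERNEL REFERENCE for the
bookkeeping both scorers (`deputy-2/score.py` v1.4, `validation/score/phasemap.py` 1.4.0) apply to such annexes:

* §1 KELVIN CONVERSION (ACCEPTANCE §2.1 annex row, v1.2 K-CONVERSION RULE; v1.3 R22 «K figures ROUNDED OUTWARD»;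
  v1.4 R30 `C1w:conv-inward`): `kelvinPerEV = e/k_B = 16021766340/1380649 K per eV` EXACTLY (SI 2019: k_B =
  1.380649·10⁻²³ J/K and e = 1.602176634·10⁻¹⁹ C are defining constants), `boundK v t = v·t·kelvinPerEV` = the
  kelvin figure of a bound quoted as `v` in units of the hopping `t` (eV). THEOREMS: `boundK_mono_right` (monotone
  in t for v ≥ 0) ⇒ THE WEAKEST-EDGE RULE IS SOUND (`le_boundK_of_le_edge`): a TRUE ceiling `T* ≤ v·t_true/k_B` at
  the material's unknown hopping `t_true ≤ t_max` implies `T* ≤ boundK v t_max` — «a screening-grade interval can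
  only make a certified UPPER bound looser, never wrong»; dually floors at `t_min` (`boundK_le_of_edge_le`); OUTWARD
  ROUNDING (`le_of_le_of_roundUp`, `le_of_roundDown_le`): printing a larger ceiling / smaller floor keeps it true.
* §2 THE H1 CHECK (§2.1 ANNEX TARGETING verbatim: «truth T_c − τ > bound ⇒ FAIL; lower bounds: bound >
  T_min_measured + 1 K on a noSC column ⇒ FAIL»): `h1UpperFail Tc τ B`, `h1LowerFail Tmin B` (Booleans).
  THEOREMS: SOUNDNESS `h1UpperFail_eq_false_of_true_bound` — if the certificate is TRUE of the material's actual
  critical temperature `T*` (`T* ≤ B`) and the curated value does not overstate it beyond the tolerance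
  (`Tc − τ ≤ T*`), the check never fires: a correct kernel statement riding on a correct dictionary is never an
  «incident»; ATTRIBUTION `lt_of_h1UpperFail` — a firing check with a true certificate forces `T* < Tc − τ`, i.e.
  every H1 incident is (certificate false) ∨ (dictionary/box false) ∨ (truth file off by > τ) — exactly the §4.1
  census classes; MONOTONICITY `h1UpperFail_mono` — loosening / rounding UP a ceiling never creates an incident, so
  C5 «the registry keeps the tighter figure» is safe: if the tighter registered ceiling passes, every re-issue above
  it passes; the mirror statements for floors. LINK TO LEVEL 3 (`h1UpperFail_eq_false_of_inside_of_w3b`): a band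
  that is INSIDE (§4.4) under W3b own-certificate consistency (band `hi ≤` own certified ceiling, v1.3 R4) makes
  the map's own ceiling H1-clean — W3b is what lets an inside band vouch for the annex riding with it.
* §3 NUMBERS OF RECORD evaluated by the kernel: the KT constant of record (π/4)·ρ̄_s = 0.2943683 t (hubbard-tc
  VERDICTS §1 R1) converts to 1366.40… K at t = 0.40 eV and 1468.88… K at 0.43 eV, so the printed «≈ 1367 K /
  1469 K» ARE the outward roundings R22 prescribes; at the LIT-PREVIEW edge 0.52 eV the exact figure is 1776.32… K,
  so day-0's «1776.3 K» was INWARD by 0.02 K (the one C1w instance deputy-2 found) and 1776.4 K is the correct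
  re-issue; against LSCO x = 0.15 truth (38 ± 2 K) every one of them is «certified, non-binding» (C8), and so is
  the 2× looser (π/2) figure 2733 K — looser is never an H1 risk.
-/

namespace Summit.Ventures.CertifiedManyBodySolver.Downfold

namespace CellScore

/-! ## §1 Kelvin conversion of a t-quoted bound -/

/-- `e / k_B` in kelvin per electron-volt, EXACT under SI 2019 (k_B = 1.380649e-23 J/K, e = 1.602176634e-19 C):
`1 eV / k_B = 16021766340 / 1380649 K ≈ 11604.518 K`. [folklore] -/
def kelvinPerEV : ℚ := 16021766340 / 1380649

/-- the kelvin figure of a bound quoted as `v` (in units of the hopping t) at hopping `t` (eV): `v · t / k_B`.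
[folklore] -/
def boundK (v t : ℚ) : ℚ := v * t * kelvinPerEV

/-- 11604 K < 1 eV/k_B < 11605 K. [folklore] -/
theorem kelvinPerEV_bounds : 11604 < kelvinPerEV ∧ kelvinPerEV < 11605 := by norm_num [kelvinPerEV]

/-- the conversion factor is positive. [folklore] -/
theorem kelvinPerEV_pos : 0 < kelvinPerEV := by norm_num [kelvinPerEV]

section conversion

variable {v t t' Tstar B B' : ℚ}

/-- `boundK` is monotone in the hopping for a non-negative coefficient. [folklore] -/
theorem boundK_mono_right (hv : 0 ≤ v) (h : t ≤ t') : boundK v t ≤ boundK v t' := by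
  unfold boundK
  have hk := kelvinPerEV_pos
  nlinarith [mul_le_mul_of_nonneg_left h hv]

/-- `boundK` is monotone in the coefficient for a non-negative hopping. [folklore] -/
theorem boundK_mono_left {v' : ℚ} (ht : 0 ≤ t) (h : v ≤ v') : boundK v t ≤ boundK v' t := by
  unfold boundK
  have hk := kelvinPerEV_pos
  nlinarith [mul_le_mul_of_nonneg_right h ht]

/-- THE WEAKEST-EDGE RULE IS SOUND (ceilings): a TRUE ceiling `T* ≤ v · t_true / k_B` at the material's actual
hopping `t_true`, which the hull only locates below `t_max`, implies the issued figure `T* ≤ boundK v t_max` — «a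
screening-grade interval can only make a certified UPPER bound looser, never wrong» (v ≥ 0). [folklore] -/
theorem le_boundK_of_le_edge (hv : 0 ≤ v) (htrue : Tstar ≤ boundK v t) (hedge : t ≤ t') : Tstar ≤ boundK v t' :=
  htrue.trans (boundK_mono_right hv hedge)

/-- … and dually for FLOORS at the lower edge `t_min`: `boundK v t_min ≤ T*`. [folklore] -/
theorem boundK_le_of_edge_le (hv : 0 ≤ v) (htrue : boundK v t ≤ Tstar) (hedge : t' ≤ t) : boundK v t' ≤ Tstar :=
  (boundK_mono_right hv hedge).trans htrue

/-- OUTWARD ROUNDING (R22): printing a ceiling as any `B' ≥ B` keeps it true … [folklore] -/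
theorem le_of_le_of_roundUp (h : Tstar ≤ B) (hup : B ≤ B') : Tstar ≤ B' := h.trans hup

/-- … and printing a floor as any `B' ≤ B` keeps it true. [folklore] -/
theorem le_of_roundDown_le (h : B ≤ Tstar) (hdown : B' ≤ B) : B' ≤ Tstar := hdown.trans h

end conversion

/-! ## §2 The H1 contradiction check on T_c bounds (ACCEPTANCE §2.1 ANNEX TARGETING, §4.1 H1) -/

/-- H1 on a certified `Tc-upper-bound-K` annex against a superconducting truth column (T_c, τ): «truth T_c − τ >
bound ⇒ FAIL». [folklore] -/
def h1UpperFail (Tc τ B : ℚ) : Bool := decide (B < Tc - τ)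

/-- H1 on a certified `Tc-lower-bound-K` annex against a measured-normal column: «bound > T_min_measured + 1 K ⇒
FAIL». [folklore] -/
def h1LowerFail (Tmin B : ℚ) : Bool := decide (Tmin + 1 < B)

section h1

variable {Tc τ Tmin B B' Tstar lo hi : ℚ}

/-- `h1UpperFail` unfolded. [folklore] -/
theorem h1UpperFail_iff : h1UpperFail Tc τ B = true ↔ B < Tc - τ := by simp [h1UpperFail]

/-- `h1LowerFail` unfolded. [folklore] -/
theorem h1LowerFail_iff : h1LowerFail Tmin B = true ↔ Tmin + 1 < B := by simp [h1LowerFail]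

/-- SOUNDNESS (ceilings): if the certificate is TRUE of the material's actual critical temperature `T*`
(`T* ≤ B`) and the curated T_c does not overstate `T*` by more than the tolerance (`Tc − τ ≤ T*`), the H1 check
never fires. [folklore] -/
theorem h1UpperFail_eq_false_of_true_bound (hcert : Tstar ≤ B) (htruth : Tc - τ ≤ Tstar) :
    h1UpperFail Tc τ B = false := by
  simp only [h1UpperFail, decide_eq_false_iff_not, not_lt]
  linarith

/-- ATTRIBUTION (ceilings): a firing check with a true certificate forces `T* < Tc − τ` — the truth file (or the
dictionary that made `B` a statement about this material) is off by more than τ. [folklore] -/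
theorem lt_of_h1UpperFail (hfail : h1UpperFail Tc τ B = true) (hcert : Tstar ≤ B) : Tstar < Tc - τ :=
  lt_of_le_of_lt hcert (h1UpperFail_iff.mp hfail)

/-- The census trichotomy, as a disjunction: an H1 incident on a ceiling means the certificate is false of `T*`
or the curated value overstates `T*` beyond τ. [folklore] -/
theorem h1Upper_census (hfail : h1UpperFail Tc τ B = true) : B < Tstar ∨ Tstar < Tc - τ := by
  by_cases h : Tstar ≤ B
  · exact Or.inr (lt_of_h1UpperFail hfail h)
  · exact Or.inl (not_le.mp h)

/-- MONOTONICITY (ceilings): loosening a ceiling (rounding UP, re-issuing at a weaker edge) never creates an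
incident — so C5 «the registry keeps the tighter figure» is safe. [folklore] -/
theorem h1UpperFail_mono (h : B ≤ B') (hok : h1UpperFail Tc τ B = false) : h1UpperFail Tc τ B' = false := by
  simp only [h1UpperFail, decide_eq_false_iff_not, not_lt] at hok ⊢
  linarith

/-- SOUNDNESS (floors): a TRUE floor `B ≤ T*` on a column measured normal down to `T_min` with `T* < T_min + 1`
(nothing superconducts at or above `T_min`, 1 K slack as the rule grants) never fires. [folklore] -/
theorem h1LowerFail_eq_false_of_true_bound (hcert : B ≤ Tstar) (htruth : Tstar ≤ Tmin + 1) :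
    h1LowerFail Tmin B = false := by
  simp only [h1LowerFail, decide_eq_false_iff_not, not_lt]
  linarith

/-- ATTRIBUTION (floors): a firing floor check with a true certificate puts `T*` above `T_min + 1` — the
measured-normal column is wrong (or the dictionary is). [folklore] -/
theorem lt_of_h1LowerFail (hfail : h1LowerFail Tmin B = true) (hcert : B ≤ Tstar) : Tmin + 1 < Tstar :=
  lt_of_lt_of_le (h1LowerFail_iff.mp hfail) hcert

/-- MONOTONICITY (floors): lowering a floor (rounding DOWN) never creates an incident. [folklore] -/
theorem h1LowerFail_anti (h : B' ≤ B) (hok : h1LowerFail Tmin B = false) : h1LowerFail Tmin B' = false := by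
  simp only [h1LowerFail, decide_eq_false_iff_not, not_lt] at hok ⊢
  linarith

/-- LINK TO LEVEL 3: a band that is INSIDE (§4.4: `Tc ≤ hi + τ`) on a map obeying W3b own-certificate consistency
(band `hi ≤` the map's own certified ceiling `B`, v1.3 R4) makes that ceiling H1-clean. [folklore] -/
theorem h1UpperFail_eq_false_of_inside_of_w3b (hin : inside lo hi Tc τ = true) (hw3b : hi ≤ B) :
    h1UpperFail Tc τ B = false := by
  obtain ⟨-, h2⟩ := inside_iff.mp hin
  simp only [h1UpperFail, decide_eq_false_iff_not, not_lt]
  linarith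

/-- Conversely an H1 incident on the map's own W3b-consistent ceiling certifies that its band is NOT inside (it
missed low by more than τ). [folklore] -/
theorem inside_eq_false_of_h1UpperFail_of_w3b (hfail : h1UpperFail Tc τ B = true) (hw3b : hi ≤ B) :
    inside lo hi Tc τ = false := by
  rw [Bool.eq_false_iff]
  intro hin
  have := h1UpperFail_eq_false_of_inside_of_w3b (lo := lo) hin hw3b
  rw [hfail] at this
  exact Bool.noConfusion this

end h1

/-! ## §3 Numbers of record -/

section cases

/-- KT constant of record (π/4)·ρ̄_s = 0.2943683 t at t = 0.40 eV: 1366.40… K ⇒ «≈ 1367 K» is the OUTWARD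
rounding (and 1366 K would be inward). [folklore] -/
example : 1366 < boundK (2943683 / 10000000) (2 / 5) ∧ boundK (2943683 / 10000000) (2 / 5) < 1367 := by
  norm_num [boundK, kelvinPerEV]

/-- at t = 0.43 eV: 1468.88… K ⇒ «1469 K» outward. [folklore] -/
example : 1468 < boundK (2943683 / 10000000) (43 / 100) ∧ boundK (2943683 / 10000000) (43 / 100) < 1469 := by
  norm_num [boundK, kelvinPerEV]

/-- at the LIT-PREVIEW edge t = 0.52 eV: 1776.32… K ⇒ day-0's printed 1776.3 K was INWARD (the C1w instance of
record, by 0.02 K) and 1776.4 K is the outward re-issue. [folklore] -/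
example : 17763 / 10 < boundK (2943683 / 10000000) (52 / 100) ∧ boundK (2943683 / 10000000) (52 / 100) < 17764 / 10 := by
  norm_num [boundK, kelvinPerEV]

/-- the weakest-edge rule in numbers: the 0.43 eV figure dominates the 0.40 eV one (v ≥ 0). [folklore] -/
example : boundK (2943683 / 10000000) (2 / 5) ≤ boundK (2943683 / 10000000) (43 / 100) :=
  boundK_mono_right (by norm_num) (by norm_num)

/-- against LSCO x = 0.15 truth (T_c = 38 ± 2 K, τ = 2): 1367 K, 1469 K, 1776.4 K and the 2× looser (π/2) figure
2733 K are all «certified, non-binding» (no H1) — looser is never an H1 risk; a ceiling of 30 K WOULD fire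
(38 − 2 > 30). [folklore] -/
example : h1UpperFail 38 2 1367 = false ∧ h1UpperFail 38 2 1469 = false ∧ h1UpperFail 38 2 (17764 / 10) = false ∧
    h1UpperFail 38 2 2733 = false ∧ h1UpperFail 38 2 30 = true := by norm_num [h1UpperFail]

/-- floors on La₂CuO₄ (no SC down to T_min = 4.2 K): a certified floor of 5 K passes (≤ T_min + 1), 6 K fires.
[folklore] -/
example : h1LowerFail (42 / 10) 5 = false ∧ h1LowerFail (42 / 10) 6 = true := by norm_num [h1LowerFail]

/-- W3b + INSIDE in numbers (MgB₂, 39 ± 1 K, τ = 1.95): band [33, 42] inside and hi = 42 ≤ own ceiling 45 K ⇒ no H1;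
a ceiling of 36 K under a band reaching 42 K is the W3b violation the gate rejects before scoring. [folklore] -/
example : inside 33 42 39 (39 / 20) = true ∧ h1UpperFail 39 (39 / 20) 45 = false ∧ h1UpperFail 39 (39 / 20) 36 = true := by
  norm_num [inside, h1UpperFail]

end cases

end CellScore

end Summit.Ventures.CertifiedManyBodySolver.Downfold
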